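import Literature.MathematicalPhysics.QuantumManyBody.BoseEinsteinCondensation
import Mathlib.MeasureTheory.Integral.MeanInequalities
import Mathlib.MeasureTheory.Measure.Prod
import Mathlib.MeasureTheory.Measure.Lebesgue.EqHaar
import Mathlib.Analysis.Real.Sqrt
import Mathlib.Analysis.SpecificLimits.Basic
import HarnessLib

/-!
# Penrose–Onsager 1956: the density-matrix criterion of Bose–Einstein condensation

Topic `Literature/MathematicalPhysics/QuantumManyBody` (litbuild of the statement source
`PenroseOnsager1956` for the conjunct `BoseEinsteinCondensation` of `AtomisticToContinuum`;
companion of `Literature.BoseGas` in `BoseEinsteinCondensation.lean`, whose `maxOccupation`,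
`condensateNumber` and `HasGroundStateBEC` are the ground-state instance of criterion (4) below).

O. Penrose, L. Onsager, *Bose–Einstein condensation and liquid helium*, Phys. Rev. **104** (1956)
576–584. We vendor §§2–4 (the rigorous part: the criterion and its equivalent forms) as real
definitions and proved theorems, and the two results of §4 whose proofs need the spectral theory
of the reduced density matrix as named facts. §5 (uniqueness/positivity of the ground state, given
there with a heuristic proof — it is Reed–Simon IV XIII.47), §6 (liquid He at `T = 0`: the `8%`
estimate (35) from Feynman's hard-sphere trial function, and the argument that a perfect crystal
shows no BEC) and §7 (Feynman's approximations imply BEC below the λ-point) are physical arguments,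
not theorems, and are not vendored.

* §2 **Asymptotic notation** for a sequence of systems `N → ∞` at fixed `N/V`:
  `IsExpOrderOne A` is P–O's `A = e^{O(1)}` ("positive constants `a₁, a₂, N₁` exist such that
  `N > N₁` implies `a₁ < A < a₂`"); P–O's `A = o(1)` is Mathlib's `Tendsto A atTop (𝓝 0)` and
  `A ≅ B` (`lim A/B = 1`) is stated as such (it is `Asymptotics.IsEquivalent` when `B ≠ 0`).
* §3 **Criterion (4)**: BEC `↔ n_M/N = e^{O(1)}`, no BEC `↔ n_M/N = o(1)`, `n_M` the largest
  eigenvalue of the one-particle reduced density matrix `σ₁ = N tr_{2…N} σ` (3), `tr σ₁ = N`.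
  `HasBEC nM`, `HasNoBEC nM` for a real sequence `N ↦ n_M(N)`; they exclude each other
  (`HasBEC.not_hasNoBEC`); Fermi systems (`n_M ≤ 1`) never condense (`hasNoBEC_of_le_one`);
  and for `0 ≤ n_M ≤ N` criterion (4) is `∃ c > 0, n_M ≥ c N` eventually
  (`hasBEC_iff_exists_mul_le`) — the form of `Literature.MathematicalPhysics.QuantumManyBody.BoseGas.HasGroundStateBEC`.
* §4 **(5)** `n_M² ≤ ∑ₐ nₐ² ≤ n_M ∑ₐ nₐ = n_M N` for the eigenvalues `nₐ ≥ 0` of `σ₁`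
  (`sq_le_tsum_sq`, `tsum_sq_le_mul_tsum`, in `ℝ≥0∞`); **(6)** `A₂ = N⁻² ∫∫ |⟨q'|σ₁|q''⟩|²`
  (`kernelA2`; the identity `A₂ = N⁻² tr σ₁² = N⁻² ∑ nₐ²` is the Hilbert–Schmidt norm of the
  integral operator and is not formalised); **(7)** `A₂ = e^{O(1)} ↔` BEC (`criterionII`, from (5)
  via the squeeze lemma `isExpOrderOne_iff_of_sq_le_of_le_mul`); **(8)**
  `A₁ = (NV)⁻¹ ∫∫ |⟨q'|σ₁|q''⟩|` (`kernelA1`); **(9)** `A₁² ≤ A₂` (`kernelA1_sq_le_kernelA2`,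
  Cauchy–Schwarz, proved); **(10)–(11)** `|⟨q'|σ₁|q''⟩| ≤ αN/V ⇒ A₂ ≤ α A₁`
  (`kernelA2_le_mul_kernelA1`, proved from the pointwise bound; the bound itself,
  `|σ₁(q',q'')|² ≤ σ₁(q',q')σ₁(q'',q'')` for the positive kernel, is hypothesis `hα`);
  **(12)** `A₁ = e^{O(1)} ↔ A₂ = e^{O(1)}` (`criterionII'`).
* §4 **(13)–(14)** the asymptotic form `|⟨q'|σ₁|q''⟩ - Ψ(q')Ψ*(q'')| ≤ (N/V) γ(|q'-q''|)`,
  `γ ≥ 0`, `γ(r) → 0` (`HasAsymptoticForm`; later called off-diagonal long-range order);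
  **Lemma (15)** `Γ(x) = V⁻¹ ∫_V γ(|x'-x|) d³x' = o(1)` uniformly in `x`
  (`setLIntegral_radial_le_of_tendsto_zero`, proved as printed: split at radius `R`,
  `V > 8πγ_M R³/3ε`); **(18)** `A₁ = (NV)⁻¹ [∫|Ψ|]² + o(1)` (named fact
  `PenroseOnsager1956_eq18`) and its consequence **criterion (19)**
  `V⁻¹∫|Ψ| d³x = e^{O(1)} ↔` BEC (`criterionIII`, proved from the fact); **(20)**
  `n_Ψ = ∫ |Ψ|² ≅ n_M` when BEC is present (named fact `PenroseOnsager1956_eq20`, with the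
  variational `kernelMaxOccupation` for `n_M`).

## Design choices

* Sequences of systems are indexed by the particle number `N : ℕ` itself (as in `Literature.BoseGas`),
  the container of the `N`-th system being a measurable `Λ_N ⊂ ℝ³` of volume `V = N/ρ`.
* The reduced density matrix enters only through its position kernel `σ : X → X → ℂ` on a
  measure space `(X, μ)` (`μ` = Lebesgue measure restricted to the container, so `V = μ univ`);
  `A₁, A₂ ∈ [0, ∞]` are lower Lebesgue integrals against `μ.prod μ` (no integrability side
  conditions; `0/0 = 0` in `ℝ≥0∞` for the empty system).
* `n_M` of a kernel (needed only to *state* (20)) is the variational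
  `sup_{‖φ‖₂ = 1} |⟨φ, σ₁ φ⟩|` (`kernelMaxOccupation`, cf. `Literature.MathematicalPhysics.QuantumManyBody.BoseGas.maxOccupation`): for the
  positive Hilbert–Schmidt operator `σ₁` this is its largest eigenvalue; P–O's (21) is exactly
  this Rayleigh quotient.
* Facts (18) and (20) carry the hypotheses P–O use: (13) on `Λ_N × Λ_N`, (14), `γ ≤ γ_M`
  ("`γ_M` is the maximum of `γ`", proof of (15)), and for (20) the diagonal bound
  `⟨q'|σ₁|q'⟩ ≤ αN/V` of (10)–(11) ("for any physical system, `α` can be chosen independent of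
  `N`"); measurability/integrability of the data is explicit. Both are provable with the tools of
  this file plus Hilbert–Schmidt bounds (triage: M each); they are vendored as facts.
* Mathlib: no density matrices/BEC (searched `Bose`, `densityMatrix`, `Onsager`, `ODLRO`);
  Hölder (`ENNReal.lintegral_mul_le_Lp_mul_Lq`), `Measure.addHaar_closedBall_center`,
  `Measure.prod` are Mathlib's.

## References

* [PenroseOnsager1956] O. Penrose, L. Onsager, *Bose–Einstein condensation and liquid helium*,
  Phys. Rev. 104 (1956) 576–584, doi:10.1103/PhysRev.104.576: §2 (notation), §3 (3)–(4),
  §4 (5)–(22).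
* [LSSY2005] E. H. Lieb, R. Seiringer, J. P. Solovej, J. Yngvason, *The Mathematics of the Bose
  Gas and its Condensation* (2005), §1.2 (1.17)–(1.19) — the same criterion for the ground state.
-/

noncomputable section

open MeasureTheory Filter Metric Topology Function
open scoped ENNReal NNReal ComplexConjugate

namespace Literature.MathematicalPhysics.QuantumManyBody.BoseGas.PenroseOnsager

/-! ### §2. Asymptotic notation along a sequence of systems `N → ∞` -/

/-- P–O's `A = e^{O(1)}`: "positive constants `a₁`, `a₂` and `N₁` exist such that `N > N₁`
implies `a₁ < A < a₂`" — `A` is eventually pinched between two positive constants ("`A` is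
finite" in P–O's idiom). Stated with `∀ᶠ N in atTop` (`Filter.eventually_atTop`).
[cite: PenroseOnsager1956, §2 p. 577] -/
def IsExpOrderOne (A : ℕ → ℝ) : Prop :=
  ∃ a₁ a₂ : ℝ, 0 < a₁ ∧ ∀ᶠ N : ℕ in atTop, a₁ < A N ∧ A N < a₂

/-- `A = e^{O(1)}` in P–O's printed form with an explicit threshold `N₁`.
[cite: PenroseOnsager1956, §2 p. 577] -/
theorem isExpOrderOne_iff (A : ℕ → ℝ) :
    IsExpOrderOne A ↔ ∃ a₁ a₂ : ℝ, 0 < a₁ ∧ ∃ N₁ : ℕ, ∀ N, N₁ < N → a₁ < A N ∧ A N < a₂ := by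
  simp only [IsExpOrderOne, eventually_atTop]
  refine exists₂_congr fun a₁ a₂ => and_congr_right fun _ => ⟨?_, ?_⟩
  · rintro ⟨N₁, h⟩
    exact ⟨N₁, fun N hN => h N hN.le⟩
  · rintro ⟨N₁, h⟩
    exact ⟨N₁ + 1, fun N hN => h N hN⟩

/-- `A = e^{O(1)}` and `A = o(1)` exclude each other. [cite: PenroseOnsager1956, §2 p. 577] -/
theorem IsExpOrderOne.not_tendsto_zero {A : ℕ → ℝ} (h : IsExpOrderOne A) :
    ¬ Tendsto A atTop (𝓝 0) := by
  rintro hA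
  obtain ⟨a₁, a₂, ha₁, h⟩ := h
  obtain ⟨N, hN₁, hN₂⟩ := ((hA.eventually (gt_mem_nhds ha₁)).and h).exists
  linarith [hN₂.1]

/-- "Evidently `A ≅ const > 0` implies `A = e^{O(1)}`" (here: `A → a > 0`).
[cite: PenroseOnsager1956, §2 p. 577] -/
theorem isExpOrderOne_of_tendsto {A : ℕ → ℝ} {a : ℝ} (ha : 0 < a) (h : Tendsto A atTop (𝓝 a)) :
    IsExpOrderOne A :=
  ⟨a / 2, 2 * a, by positivity,
    (h.eventually (Ioo_mem_nhds (by linarith : a / 2 < a) (by linarith : a < 2 * a))).mono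
      fun _ hN => hN⟩

/-- **Squeeze lemma behind (7) and (12).** If eventually `0 ≤ x`, `x² ≤ y ≤ c x` (`c > 0`), then
`x = e^{O(1)} ↔ y = e^{O(1)}`. [cite: PenroseOnsager1956, §4 (5)–(7) and (9)–(12)] -/
theorem isExpOrderOne_iff_of_sq_le_of_le_mul {x y : ℕ → ℝ} {c : ℝ} (hc : 0 < c)
    (h0 : ∀ᶠ N in atTop, 0 ≤ x N) (h1 : ∀ᶠ N in atTop, x N ^ 2 ≤ y N)
    (h2 : ∀ᶠ N in atTop, y N ≤ c * x N) : IsExpOrderOne x ↔ IsExpOrderOne y := by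
  constructor
  · rintro ⟨a₁, a₂, ha₁, h⟩
    refine ⟨a₁ ^ 2, c * a₂, by positivity, ?_⟩
    filter_upwards [h, h0, h1, h2] with N hN hx hxy hyx
    exact ⟨(pow_lt_pow_left₀ hN.1 ha₁.le two_ne_zero).trans_le hxy,
      hyx.trans_lt (mul_lt_mul_of_pos_left hN.2 hc)⟩
  · rintro ⟨a₁, a₂, ha₁, h⟩
    refine ⟨a₁ / c, Real.sqrt a₂, by positivity, ?_⟩
    filter_upwards [h, h0, h1, h2] with N hN hx hxy hyx
    refine ⟨?_, (Real.lt_sqrt hx).2 (hxy.trans_lt hN.2)⟩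
    rw [div_lt_iff₀ hc]
    linarith [hN.1]

/-- Companion of the squeeze lemma for the `o(1)` alternatives: under the same hypotheses
`x = o(1) ↔ y = o(1)`. [cite: PenroseOnsager1956, §4 (5)–(7) and (9)–(12)] -/
theorem tendsto_zero_iff_of_sq_le_of_le_mul {x y : ℕ → ℝ} {c : ℝ}
    (h0 : ∀ᶠ N in atTop, 0 ≤ x N) (h1 : ∀ᶠ N in atTop, x N ^ 2 ≤ y N)
    (h2 : ∀ᶠ N in atTop, y N ≤ c * x N) :
    Tendsto x atTop (𝓝 0) ↔ Tendsto y atTop (𝓝 0) := by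
  constructor
  · intro hx
    refine squeeze_zero' (h1.mono fun N h => (sq_nonneg _).trans h) h2 ?_
    simpa using hx.const_mul c
  · intro hy
    have hs : Tendsto (fun N => Real.sqrt (y N)) atTop (𝓝 0) := by simpa using hy.sqrt
    refine squeeze_zero' h0 ?_ hs
    filter_upwards [h0, h1] with N hx hxy
    exact Real.le_sqrt_of_sq_le hxy

/-- **Squeeze lemma behind (19).** If eventually `0 ≤ x` and `A - c x² = o(1)` (`c > 0`), then
`A = e^{O(1)} ↔ x = e^{O(1)}`. [cite: PenroseOnsager1956, §4 (18)–(19)] -/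
theorem isExpOrderOne_iff_of_tendsto_sub_mul_sq {A x : ℕ → ℝ} {c : ℝ} (hc : 0 < c)
    (h0 : ∀ᶠ N in atTop, 0 ≤ x N) (h : Tendsto (fun N => A N - c * x N ^ 2) atTop (𝓝 0)) :
    IsExpOrderOne A ↔ IsExpOrderOne x := by
  constructor
  · rintro ⟨a₁, a₂, ha₁, hA⟩
    have hδ := h.eventually (Ioo_mem_nhds (by linarith : -(a₁ / 2) < (0 : ℝ)) (half_pos ha₁))
    refine ⟨Real.sqrt (a₁ / (2 * c)), Real.sqrt ((a₂ + a₁ / 2) / c) + 1, by positivity, ?_⟩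
    filter_upwards [hA, hδ, h0] with N hN hd hx
    obtain ⟨hd₁, hd₂⟩ := hd
    constructor
    · have hx2 : a₁ / (2 * c) < x N ^ 2 := by
        rw [div_lt_iff₀ (by positivity)]
        nlinarith [hN.1]
      exact (Real.sqrt_lt_sqrt (by positivity) hx2).trans_eq (Real.sqrt_sq hx)
    · have : x N ≤ Real.sqrt ((a₂ + a₁ / 2) / c) := by
        refine Real.le_sqrt_of_sq_le ?_
        rw [le_div_iff₀ hc]
        nlinarith [hN.2]
      linarith
  · rintro ⟨a₁, a₂, ha₁, hxb⟩
    have hca : (0 : ℝ) < c * a₁ ^ 2 / 2 := by positivity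
    have hδ := h.eventually (Ioo_mem_nhds (by linarith : -(c * a₁ ^ 2 / 2) < (0 : ℝ)) hca)
    refine ⟨c * a₁ ^ 2 / 2, c * a₂ ^ 2 + c * a₁ ^ 2 / 2, by positivity, ?_⟩
    filter_upwards [hxb, hδ, h0] with N hN hd hx
    obtain ⟨hd₁, hd₂⟩ := hd
    have h1 : a₁ ^ 2 < x N ^ 2 := pow_lt_pow_left₀ hN.1 ha₁.le two_ne_zero
    have h2 : x N ^ 2 < a₂ ^ 2 := pow_lt_pow_left₀ hN.2 hx two_ne_zero
    constructor <;> nlinarith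

/-! ### §3. The criterion (4) -/

/-- **Penrose–Onsager criterion of B.E. condensation, (4), first line**: along the sequence of
systems, `n_M / N = e^{O(1)}`, where `nM N` is the largest eigenvalue of the one-particle reduced
density matrix `σ₁ = N tr_{2…N}(σ)` ((3); `tr σ₁ = N`) of the `N`-particle system.
[cite: PenroseOnsager1956, §3 (4)] -/
def HasBEC (nM : ℕ → ℝ) : Prop :=
  IsExpOrderOne fun N => nM N / N

/-- **(4), second line**: no B.E. condensation `↔ n_M / N = o(1)`.
[cite: PenroseOnsager1956, §3 (4)] -/
def HasNoBEC (nM : ℕ → ℝ) : Prop :=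
  Tendsto (fun N => nM N / N) atTop (𝓝 0)

/-- The two lines of (4) exclude each other (they are not exhaustive: `2 + sin N`).
[cite: PenroseOnsager1956, §2–§3] -/
theorem HasBEC.not_hasNoBEC {nM : ℕ → ℝ} (h : HasBEC nM) : ¬ HasNoBEC nM :=
  IsExpOrderOne.not_tendsto_zero h

/-- "According to our criterion (4), B.E. condensation cannot occur in a Fermi system, because the
exclusion principle implies that `0 ≤ n_M ≤ 1`." [cite: PenroseOnsager1956, §3 (after (4))] -/
theorem hasNoBEC_of_le_one {nM : ℕ → ℝ} (h0 : ∀ N, 0 ≤ nM N) (h1 : ∀ N, nM N ≤ 1) :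
    HasNoBEC nM := by
  refine squeeze_zero (fun N => div_nonneg (h0 N) N.cast_nonneg)
    (fun N => div_le_div_of_nonneg_right (h1 N) N.cast_nonneg) ?_
  exact tendsto_one_div_atTop_nhds_zero_nat

/-- For Bose systems `n_M ≤ N` ("a consequence of the identity `tr σ₁ = N`" and positivity), and
then criterion (4) reads: `∃ c > 0`, `n_M ≥ c N` for all large `N` — the form used in
`Literature.MathematicalPhysics.QuantumManyBody.BoseGas.HasGroundStateBEC` and LSSY (1.19). [cite: PenroseOnsager1956, §3 (4) and the
sentence on Bose systems following it] -/
theorem hasBEC_iff_exists_mul_le {nM : ℕ → ℝ} (h1 : ∀ N, nM N ≤ N) :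
    HasBEC nM ↔ ∃ c : ℝ, 0 < c ∧ ∀ᶠ N : ℕ in atTop, c * N ≤ nM N := by
  constructor
  · rintro ⟨a₁, a₂, ha₁, h⟩
    refine ⟨a₁, ha₁, ?_⟩
    filter_upwards [h, eventually_gt_atTop 0] with N hN hN0
    have hN0' : (0 : ℝ) < N := Nat.cast_pos.2 hN0
    exact ((lt_div_iff₀ hN0').1 hN.1).le
  · rintro ⟨c, hc, h⟩
    refine ⟨c / 2, 2, by positivity, ?_⟩
    filter_upwards [h, eventually_gt_atTop 0] with N hN hN0
    have hN0' : (0 : ℝ) < N := Nat.cast_pos.2 hN0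
    constructor
    · rw [lt_div_iff₀ hN0']
      nlinarith
    · rw [div_lt_iff₀ hN0']
      linarith [h1 N]

/-! ### §4. Alternative forms of the criterion

#### (5)–(7): the eigenvalue sums -/

/-- **(5), left inequality**: `n_M² ≤ ∑ₐ nₐ²` (indeed for every eigenvalue).
[cite: PenroseOnsager1956, §4 (5)] -/
theorem sq_le_tsum_sq {ι : Type*} (n : ι → ℝ≥0∞) (a₀ : ι) : n a₀ ^ 2 ≤ ∑' a, n a ^ 2 :=
  ENNReal.le_tsum (f := fun a => n a ^ 2) a₀

/-- **(5), right inequality**: `∑ₐ nₐ² ≤ n_M ∑ₐ nₐ (= n_M N)` when `n_M = n a₀` is the largest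
eigenvalue. [cite: PenroseOnsager1956, §4 (5)] -/
theorem tsum_sq_le_mul_tsum {ι : Type*} (n : ι → ℝ≥0∞) {a₀ : ι} (h : ∀ a, n a ≤ n a₀) :
    ∑' a, n a ^ 2 ≤ n a₀ * ∑' a, n a := by
  rw [← ENNReal.tsum_mul_left]
  exact ENNReal.tsum_le_tsum fun a => by rw [sq]; gcongr; exact h a

/-- **Criterion (7) ↔ criterion (4).** With `A₂ = N⁻² ∑ₐ nₐ²` ((6): `= N⁻² tr σ₁² =
N⁻² ∫∫|⟨q'|σ₁|q''⟩|²`), (5) gives `(n_M/N)² ≤ A₂ ≤ n_M/N`, hence `A₂ = e^{O(1)} ↔ n_M/N = e^{O(1)}`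
and `A₂ = o(1) ↔ n_M/N = o(1)`. Stated for real sequences `nM ≥ 0`, `S₂ = ∑ₐ nₐ²` satisfying (5)
with `∑ₐ nₐ = N`. [cite: PenroseOnsager1956, §4 (5)–(7)] -/
theorem criterionII {nM S₂ : ℕ → ℝ} (h0 : ∀ N, 0 ≤ nM N) (h5 : ∀ N, nM N ^ 2 ≤ S₂ N)
    (h5' : ∀ N, S₂ N ≤ nM N * N) :
    (HasBEC nM ↔ IsExpOrderOne fun N => S₂ N / (N : ℝ) ^ 2) ∧
      (HasNoBEC nM ↔ Tendsto (fun N => S₂ N / (N : ℝ) ^ 2) atTop (𝓝 0)) := by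
  have e0 : ∀ᶠ N : ℕ in atTop, 0 ≤ nM N / N := .of_forall fun N => div_nonneg (h0 N) N.cast_nonneg
  have e1 : ∀ᶠ N : ℕ in atTop, (nM N / N) ^ 2 ≤ S₂ N / (N : ℝ) ^ 2 := by
    filter_upwards [eventually_gt_atTop 0] with N hN
    rw [div_pow]
    gcongr
    exact h5 N
  have e2 : ∀ᶠ N : ℕ in atTop, S₂ N / (N : ℝ) ^ 2 ≤ 1 * (nM N / N) := by
    filter_upwards [eventually_gt_atTop 0] with N hN
    have hN' : (0 : ℝ) < N := Nat.cast_pos.2 hN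
    rw [one_mul, div_le_div_iff₀ (by positivity) hN', sq, ← mul_assoc]
    exact mul_le_mul_of_nonneg_right (h5' N) hN'.le
  exact ⟨isExpOrderOne_iff_of_sq_le_of_le_mul one_pos e0 e1 e2,
    tendsto_zero_iff_of_sq_le_of_le_mul e0 e1 e2⟩

/-! #### (6), (8)–(12): the kernel functionals `A₂`, `A₁` -/

section Kernel

variable {X : Type*} [MeasurableSpace X]

/-- **(6)** `A₂ = N⁻² ∫_V ∫_V |⟨q'|σ₁|q''⟩|² d³q' d³q''` for the position kernel `σ` of the reduced
density matrix on the container (`μ` = Lebesgue measure restricted to it).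
[cite: PenroseOnsager1956, §4 (6)] -/
def kernelA2 (μ : Measure X) (N : ℕ) (σ : X → X → ℂ) : ℝ≥0∞ :=
  (∫⁻ p, (‖σ p.1 p.2‖₊ : ℝ≥0∞) ^ 2 ∂(μ.prod μ)) / (N : ℝ≥0∞) ^ 2

/-- **(8)** `A₁ = (NV)⁻¹ ∫_V ∫_V |⟨q'|σ₁|q''⟩| d³q' d³q''`, `V = μ univ` the volume of the container.
[cite: PenroseOnsager1956, §4 (8)] -/
def kernelA1 (μ : Measure X) (N : ℕ) (σ : X → X → ℂ) : ℝ≥0∞ :=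
  (∫⁻ p, (‖σ p.1 p.2‖₊ : ℝ≥0∞) ∂(μ.prod μ)) / ((N : ℝ≥0∞) * μ Set.univ)

/-- Cauchy–Schwarz in the form used for (9): `(∫ f dν)² ≤ ν(univ) ∫ f² dν` ("the square of the
mean value cannot exceed the mean value of the square"). [folklore] -/
theorem lintegral_sq_le_mul_lintegral_sq {α : Type*} [MeasurableSpace α] (ν : Measure α)
    {f : α → ℝ≥0∞} (hf : AEMeasurable f ν) :
    (∫⁻ a, f a ∂ν) ^ 2 ≤ ν Set.univ * ∫⁻ a, f a ^ 2 ∂ν := by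
  have h := ENNReal.lintegral_mul_le_Lp_mul_Lq ν Real.HolderConjugate.two_two hf
    (g := fun _ => 1) aemeasurable_const
  simp only [Pi.mul_apply, mul_one, ENNReal.one_rpow, lintegral_const, one_mul] at h
  calc (∫⁻ a, f a ∂ν) ^ 2
      ≤ ((∫⁻ a, f a ^ (2 : ℝ) ∂ν) ^ (1 / (2 : ℝ)) * ν Set.univ ^ (1 / (2 : ℝ))) ^ 2 := by
        gcongr
    _ = ν Set.univ * ∫⁻ a, f a ^ 2 ∂ν := by
        rw [mul_pow, ← ENNReal.rpow_two, ← ENNReal.rpow_two, ← ENNReal.rpow_mul,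
          ← ENNReal.rpow_mul, mul_comm]
        norm_num

/-- **(9)** `A₁² ≤ A₂`. [cite: PenroseOnsager1956, §4 (9)] -/
theorem kernelA1_sq_le_kernelA2 (μ : Measure X) [IsFiniteMeasure μ] (N : ℕ) {σ : X → X → ℂ}
    (hσ : Measurable (uncurry σ)) : kernelA1 μ N σ ^ 2 ≤ kernelA2 μ N σ := by
  have hf : AEMeasurable (fun p : X × X => (‖σ p.1 p.2‖₊ : ℝ≥0∞)) (μ.prod μ) :=
    hσ.nnnorm.coe_nnreal_ennreal.aemeasurable
  have hcs := lintegral_sq_le_mul_lintegral_sq (μ.prod μ) hf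
  rw [← Set.univ_prod_univ, Measure.prod_prod] at hcs
  unfold kernelA1 kernelA2
  rcases eq_or_ne (μ Set.univ) 0 with hV | hV
  · have hμ : μ = 0 := Measure.measure_univ_eq_zero.1 hV
    subst hμ
    simp [Measure.prod_zero]
  · calc ((∫⁻ p, (‖σ p.1 p.2‖₊ : ℝ≥0∞) ∂μ.prod μ) / ((N : ℝ≥0∞) * μ Set.univ)) ^ 2
        = (∫⁻ p, (‖σ p.1 p.2‖₊ : ℝ≥0∞) ∂μ.prod μ) ^ 2 / (μ Set.univ ^ 2 * (N : ℝ≥0∞) ^ 2) := by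
          rw [div_eq_mul_inv, mul_pow, ← ENNReal.inv_pow, mul_pow, mul_comm (_ ^ 2) (_ ^ 2),
            div_eq_mul_inv]
      _ ≤ (μ Set.univ ^ 2 * ∫⁻ p, (‖σ p.1 p.2‖₊ : ℝ≥0∞) ^ 2 ∂μ.prod μ) /
            (μ Set.univ ^ 2 * (N : ℝ≥0∞) ^ 2) := by
          gcongr
          rwa [sq (μ Set.univ)]
      _ = _ := ENNReal.mul_div_mul_left _ _ (pow_ne_zero 2 hV) (by finiteness)

/-- **(10)–(11)** If `|⟨q'|σ₁|q''⟩| ≤ α N/V` a.e. on the container (for the positive semidefinite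
`σ₁`, (10): `|⟨q'|σ₁|q''⟩| ≤ [⟨q'|σ₁|q'⟩⟨q''|σ₁|q''⟩]^{1/2} ≤ αN/V` with `αN/V` any bound of the
density `⟨q'|σ₁|q'⟩`), then `A₂ ≤ α A₁`. [cite: PenroseOnsager1956, §4 (10)–(11)] -/
theorem kernelA2_le_mul_kernelA1 (μ : Measure X) [IsFiniteMeasure μ] {N : ℕ} (hN : N ≠ 0)
    (hV : μ Set.univ ≠ 0) {σ : X → X → ℂ} {α : ℝ≥0}
    (hα : ∀ᵐ p ∂(μ.prod μ), (‖σ p.1 p.2‖₊ : ℝ≥0∞) ≤ (α : ℝ≥0∞) * N / μ Set.univ) :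
    kernelA2 μ N σ ≤ α * kernelA1 μ N σ := by
  unfold kernelA1 kernelA2
  have hN' : (N : ℝ≥0∞) ≠ 0 := Nat.cast_ne_zero.2 hN
  calc (∫⁻ p, (‖σ p.1 p.2‖₊ : ℝ≥0∞) ^ 2 ∂μ.prod μ) / (N : ℝ≥0∞) ^ 2
      ≤ (∫⁻ p, (α : ℝ≥0∞) * N / μ Set.univ * (‖σ p.1 p.2‖₊ : ℝ≥0∞) ∂μ.prod μ) /
          (N : ℝ≥0∞) ^ 2 := by
        refine ENNReal.div_le_div_right (lintegral_mono_ae (hα.mono fun p hp => ?_)) _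
        rw [sq]
        exact mul_le_mul_left hp _
    _ = (α : ℝ≥0∞) * kernelA1 μ N σ := by
        unfold kernelA1
        rw [lintegral_const_mul' _ _ (ENNReal.div_ne_top (by finiteness) hV), mul_div_assoc,
          mul_div_assoc, mul_assoc]
        congr 1
        rw [div_eq_mul_inv, div_eq_mul_inv, div_eq_mul_inv, ENNReal.mul_inv (Or.inl hN')
          (Or.inl (by finiteness)), sq, ENNReal.mul_inv (Or.inl hN') (Or.inl (by finiteness))]
        have h1 : (N : ℝ≥0∞) * (N : ℝ≥0∞)⁻¹ = 1 := ENNReal.mul_inv_cancel hN' (by finiteness)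
        calc (N : ℝ≥0∞) * (μ Set.univ)⁻¹ * ((∫⁻ p, (‖σ p.1 p.2‖₊ : ℝ≥0∞) ∂μ.prod μ) *
              ((N : ℝ≥0∞)⁻¹ * (N : ℝ≥0∞)⁻¹))
            = (N : ℝ≥0∞) * (N : ℝ≥0∞)⁻¹ * ((∫⁻ p, (‖σ p.1 p.2‖₊ : ℝ≥0∞) ∂μ.prod μ) *
              ((N : ℝ≥0∞)⁻¹ * (μ Set.univ)⁻¹)) := by ring
          _ = _ := by rw [h1, one_mul]

/-- **Criterion (12) ↔ criterion (7)**: from (9) `A₁² ≤ A₂` and (11) `A₂ ≤ α A₁` (eventually,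
`α > 0` independent of `N`), `A₁ = e^{O(1)} ↔ A₂ = e^{O(1)}` and `A₁ = o(1) ↔ A₂ = o(1)`; for
real sequences (apply to `(kernelA1 …).toReal`, `(kernelA2 …).toReal`).
[cite: PenroseOnsager1956, §4 (12)] -/
theorem criterionII' {A₁ A₂ : ℕ → ℝ} {α : ℝ} (hα : 0 < α) (h0 : ∀ᶠ N in atTop, 0 ≤ A₁ N)
    (h9 : ∀ᶠ N in atTop, A₁ N ^ 2 ≤ A₂ N) (h11 : ∀ᶠ N in atTop, A₂ N ≤ α * A₁ N) :
    (IsExpOrderOne A₁ ↔ IsExpOrderOne A₂) ∧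
      (Tendsto A₁ atTop (𝓝 0) ↔ Tendsto A₂ atTop (𝓝 0)) :=
  ⟨isExpOrderOne_iff_of_sq_le_of_le_mul hα h0 h9 h11,
    tendsto_zero_iff_of_sq_le_of_le_mul h0 h9 h11⟩

/-! #### (13)–(20): the asymptotic form `Ψ(q')Ψ*(q'')` -/

/-- **(13)** The reduced density matrix has the asymptotic form `Ψ(q')Ψ*(q'')` on the container
`Λ`, with error `|⟨q'|σ₁|q''⟩ - Ψ(q')Ψ*(q'')| ≤ ρ γ(|q'-q''|)`, `ρ = N/V`; here `γ ≥ 0` is to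
satisfy (14) `γ(r) → 0` (P–O's precursor of off-diagonal long-range order; `Ψ` is then "the wave
function of the condensed particles"). [cite: PenroseOnsager1956, §4 (13)–(14)] -/
def HasAsymptoticForm {Y : Type*} [Dist Y] (ρ : ℝ) (σ : Y → Y → ℂ) (Ψ : Y → ℂ) (γ : ℝ → ℝ)
    (Λ : Set Y) : Prop :=
  ∀ q' ∈ Λ, ∀ q'' ∈ Λ, ‖σ q' q'' - Ψ q' * conj (Ψ q'')‖ ≤ ρ * γ (dist q' q'')

/-- **Lemma (15)**: if `0 ≤ γ ≤ γ_M` and `γ(r) → 0` as `r → ∞`, then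
`Γ(x) = V⁻¹ ∫_V γ(|x' - x|) d³x' = o(1)` as `V → ∞`, uniformly in `x` and in the shape of the
region: for every `ε > 0` there is a finite `V₀` ("`V > 8πγ_M R³/3ε`") such that
`∫_Λ γ(|x'-x|) dx' ≤ ε V` for every measurable `Λ` of volume `V ≥ V₀`. Any additive Haar measure
on a proper normed group (Lebesgue on `ℝ³`). [cite: PenroseOnsager1956, §4 Lemma (15)–(16)] -/
theorem setLIntegral_radial_le_of_tendsto_zero {E : Type*} [NormedAddCommGroup E]
    [MeasurableSpace E] [BorelSpace E] [ProperSpace E] (μ : Measure E) [μ.IsAddHaarMeasure]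
    {γ : ℝ → ℝ} {γM : ℝ} (hγ0 : ∀ r, 0 ≤ γ r) (hγM : ∀ r, γ r ≤ γM)
    (hγ : Tendsto γ atTop (𝓝 0)) {ε : ℝ} (hε : 0 < ε) :
    ∃ V₀ : ℝ≥0∞, V₀ ≠ ∞ ∧ ∀ Λ : Set E, MeasurableSet Λ → V₀ ≤ μ Λ → ∀ x : E,
      ∫⁻ x' in Λ, ENNReal.ofReal (γ (dist x' x)) ∂μ ≤ ENNReal.ofReal ε * μ Λ := by
  -- (16): `0 ≤ γ(r) < ε/2` for `r > R`
  obtain ⟨R, hR⟩ := eventually_atTop.1 (hγ.eventually (gt_mem_nhds (half_pos hε)))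
  have hγM0 : 0 ≤ γM := (hγ0 0).trans (hγM 0)
  set b : ℝ≥0∞ := μ (closedBall (0 : E) R) with hb
  have hbtop : b ≠ ∞ := measure_closedBall_lt_top.ne
  refine ⟨ENNReal.ofReal (2 * γM / ε) * b, ENNReal.mul_ne_top ENNReal.ofReal_ne_top hbtop,
    fun Λ hΛ hV x => ?_⟩
  have hsplit : Λ = (Λ ∩ closedBall x R) ∪ (Λ \ closedBall x R) :=
    (Set.inter_union_sdiff Λ _).symm
  -- near part: `≤ γ_M vol(B_R)`
  have hnear : ∫⁻ x' in Λ ∩ closedBall x R, ENNReal.ofReal (γ (dist x' x)) ∂μ ≤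
      ENNReal.ofReal γM * b := by
    calc ∫⁻ x' in Λ ∩ closedBall x R, ENNReal.ofReal (γ (dist x' x)) ∂μ
        ≤ ∫⁻ _ in Λ ∩ closedBall x R, ENNReal.ofReal γM ∂μ :=
          lintegral_mono fun x' => ENNReal.ofReal_le_ofReal (hγM _)
      _ = ENNReal.ofReal γM * μ (Λ ∩ closedBall x R) := setLIntegral_const _ _
      _ ≤ ENNReal.ofReal γM * b := by
          rw [hb, ← Measure.addHaar_closedBall_center μ x R]
          exact mul_le_mul_right (measure_mono Set.inter_subset_right) _
  -- far part: `≤ (ε/2) V`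
  have hfar : ∫⁻ x' in Λ \ closedBall x R, ENNReal.ofReal (γ (dist x' x)) ∂μ ≤
      ENNReal.ofReal (ε / 2) * μ Λ := by
    calc ∫⁻ x' in Λ \ closedBall x R, ENNReal.ofReal (γ (dist x' x)) ∂μ
        ≤ ∫⁻ _ in Λ \ closedBall x R, ENNReal.ofReal (ε / 2) ∂μ := by
          refine setLIntegral_mono' (hΛ.diff measurableSet_closedBall) fun x' hx' => ?_
          refine ENNReal.ofReal_le_ofReal (hR _ ?_).le
          have : ¬ dist x' x ≤ R := fun h => hx'.2 (mem_closedBall.2 h)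
          exact (not_le.1 this).le
      _ = ENNReal.ofReal (ε / 2) * μ (Λ \ closedBall x R) := setLIntegral_const _ _
      _ ≤ ENNReal.ofReal (ε / 2) * μ Λ := mul_le_mul_right (measure_mono Set.sdiff_subset) _
  -- the choice of `V₀`: `γ_M vol(B_R) ≤ (ε/2) V₀ ≤ (ε/2) V`
  have hV₀ : ENNReal.ofReal γM * b ≤ ENNReal.ofReal (ε / 2) * μ Λ := by
    calc ENNReal.ofReal γM * b = ENNReal.ofReal (ε / 2) * (ENNReal.ofReal (2 * γM / ε) * b) := by
          rw [← mul_assoc, ← ENNReal.ofReal_mul (by positivity)]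
          congr 2
          field_simp
      _ ≤ ENNReal.ofReal (ε / 2) * μ Λ := mul_le_mul_right hV _
  calc ∫⁻ x' in Λ, ENNReal.ofReal (γ (dist x' x)) ∂μ
      ≤ ∫⁻ x' in Λ ∩ closedBall x R, ENNReal.ofReal (γ (dist x' x)) ∂μ +
          ∫⁻ x' in Λ \ closedBall x R, ENNReal.ofReal (γ (dist x' x)) ∂μ := by
        conv_lhs => rw [hsplit]
        exact lintegral_union_le _ _ _
    _ ≤ ENNReal.ofReal (ε / 2) * μ Λ + ENNReal.ofReal (ε / 2) * μ Λ :=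
        add_le_add (hnear.trans hV₀) hfar
    _ = ENNReal.ofReal ε * μ Λ := by
        rw [← add_mul, ← ENNReal.ofReal_add (by positivity) (by positivity), add_halves]

end Kernel

/-! #### (18)–(20): sequences of systems in `ℝ³`

The `N`-th system lives in a measurable container `Λ N ⊂ ℝ³` (`Space`) of volume `V = N/ρ`
(fixed density `ρ = N/V`), with reduced density matrix kernel `σ N` and candidate condensate wave
function `Ψ N`. -/

/-- The quadratic form `⟨φ, σ₁ φ⟩ = ∫_V ∫_V φ*(q') ⟨q'|σ₁|q''⟩ φ(q'') d³q' d³q''` of the reduced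
density matrix on a one-particle mode `φ` (P–O's `N · f{φ}` of (21); Bochner integrals, `0` if
not integrable). [cite: PenroseOnsager1956, §4 (21)] -/
def kernelOccupation (Λ : Set Space) (σ : Space → Space → ℂ) (φ : Space → ℂ) : ℂ :=
  ∫ q' in Λ, ∫ q'' in Λ, conj (φ q') * σ q' q'' * φ q''

/-- The largest eigenvalue `n_M` of the reduced density matrix with kernel `σ` on the container
`Λ`, variationally: `sup_{‖φ‖₂ = 1} |⟨φ, σ₁ φ⟩|` over normalised measurable modes ("the maximum
value of `f{φ}` is `n_M/N`, and it is attained when `φ` equals `φ_M`"); for the positive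
semidefinite Hilbert–Schmidt `σ₁` this is its largest eigenvalue (cf.
`Literature.MathematicalPhysics.QuantumManyBody.BoseGas.maxOccupation`). [cite: PenroseOnsager1956, §4 (21) and the paragraph following it] -/
def kernelMaxOccupation (Λ : Set Space) (σ : Space → Space → ℂ) : ℝ≥0∞ :=
  ⨆ (φ : Space → ℂ) (_ : AEStronglyMeasurable φ (volume.restrict Λ) ∧
      ∫⁻ x in Λ, (‖φ x‖₊ : ℝ≥0∞) ^ 2 = 1), (‖kernelOccupation Λ σ φ‖₊ : ℝ≥0∞)

/-- Every normalised measurable mode bounds `n_M` from below by `|⟨φ, σ₁ φ⟩|` (definition of the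
supremum). [cite: PenroseOnsager1956, §4 (21)] -/
theorem nnnorm_kernelOccupation_le {Λ : Set Space} (σ : Space → Space → ℂ) {φ : Space → ℂ}
    (hφ : AEStronglyMeasurable φ (volume.restrict Λ))
    (hφ₁ : ∫⁻ x in Λ, (‖φ x‖₊ : ℝ≥0∞) ^ 2 = 1) :
    (‖kernelOccupation Λ σ φ‖₊ : ℝ≥0∞) ≤ kernelMaxOccupation Λ σ :=
  le_iSup₂ (f := fun φ _ => (‖kernelOccupation Λ σ φ‖₊ : ℝ≥0∞)) φ ⟨hφ, hφ₁⟩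

/-- **(17)–(18)** (named literature fact). Along a sequence of systems in measurable containers
`Λ_N ⊂ ℝ³` of volume `V = N/ρ`, if the reduced density matrices have the asymptotic form (13),
`|⟨q'|σ₁|q''⟩ - Ψ(q')Ψ*(q'')| ≤ (N/V) γ(|q'-q''|)` on `Λ_N`, with `0 ≤ γ ≤ γ_M` independent of `N`
and (14) `γ(r) → 0`, then `A₁ = (NV)⁻¹ [∫_V |Ψ(x)| d³x]² + o(1)`. (Proof in print: (17)
`(NV)⁻¹∫∫|σ₁ - ΨΨ*| = o(1)` by (13) and Lemma (15), then `| |u| - |v| | ≤ |u - v|`.)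
Regularity made explicit: `σ_N` measurable, `Ψ_N` integrable on `Λ_N`.
[cite: PenroseOnsager1956, §4 (17)–(18)] -/
def PenroseOnsager1956_eq18 : Prop :=
  ∀ (ρ : ℝ) (Λ : ℕ → Set Space) (σ : ℕ → Space → Space → ℂ) (Ψ : ℕ → Space → ℂ) (γ : ℝ → ℝ)
    (γM : ℝ), 0 < ρ → (∀ N, MeasurableSet (Λ N)) →
    (∀ᶠ N : ℕ in atTop, volume (Λ N) = ENNReal.ofReal (N / ρ)) →
    (∀ N, Measurable (uncurry (σ N))) → (∀ N, IntegrableOn (Ψ N) (Λ N)) →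
    (∀ r, 0 ≤ γ r) → (∀ r, γ r ≤ γM) → Tendsto γ atTop (𝓝 0) →
    (∀ᶠ N in atTop, HasAsymptoticForm ρ (σ N) (Ψ N) γ (Λ N)) →
    Tendsto (fun N : ℕ => (kernelA1 (volume.restrict (Λ N)) N (σ N)).toReal
      - ((N : ℝ) * (N / ρ))⁻¹ * (∫ x in Λ N, ‖Ψ N x‖) ^ 2) atTop (𝓝 0)

/-- **Criterion (19)** (third form of the criterion), from the fact (18): whenever (13)–(14)
hold along the sequence, B.E. condensation in the form (12) `A₁ = e^{O(1)}` is equivalent to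
`V⁻¹ ∫_V |Ψ(x)| d³x = e^{O(1)}`. [cite: PenroseOnsager1956, §4 (19)] -/
theorem criterionIII (h18 : PenroseOnsager1956_eq18) {ρ : ℝ} {Λ : ℕ → Set Space}
    {σ : ℕ → Space → Space → ℂ} {Ψ : ℕ → Space → ℂ} {γ : ℝ → ℝ} {γM : ℝ} (hρ : 0 < ρ)
    (hΛ : ∀ N, MeasurableSet (Λ N))
    (hV : ∀ᶠ N : ℕ in atTop, volume (Λ N) = ENNReal.ofReal (N / ρ))
    (hσ : ∀ N, Measurable (uncurry (σ N))) (hΨ : ∀ N, IntegrableOn (Ψ N) (Λ N))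
    (hγ0 : ∀ r, 0 ≤ γ r) (hγM : ∀ r, γ r ≤ γM) (hγ : Tendsto γ atTop (𝓝 0))
    (h13 : ∀ᶠ N in atTop, HasAsymptoticForm ρ (σ N) (Ψ N) γ (Λ N)) :
    IsExpOrderOne (fun N => (kernelA1 (volume.restrict (Λ N)) N (σ N)).toReal) ↔
      IsExpOrderOne (fun N => (volume (Λ N)).toReal⁻¹ * ∫ x in Λ N, ‖Ψ N x‖) := by
  have h := h18 ρ Λ σ Ψ γ γM hρ hΛ hV hσ hΨ hγ0 hγM hγ h13
  refine isExpOrderOne_iff_of_tendsto_sub_mul_sq (c := ρ⁻¹) (by positivity)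
    (.of_forall fun N => mul_nonneg (inv_nonneg.2 ENNReal.toReal_nonneg)
      (integral_nonneg fun _ => norm_nonneg _)) (h.congr' ?_)
  filter_upwards [hV, eventually_gt_atTop 0] with N hVN hN
  have hN' : (0 : ℝ) < N := Nat.cast_pos.2 hN
  rw [hVN, ENNReal.toReal_ofReal (by positivity)]
  congr 1
  field_simp

/-- **(20)** (named literature fact). In the setting of (18), assume moreover the density bound
`⟨q'|σ₁|q'⟩ ≤ α N/V` on `Λ_N` used in (10)–(11) ("`α` can be chosen independent of `N`") and
that B.E. condensation is present in the form (19), `V⁻¹ ∫_V |Ψ| d³x = e^{O(1)}`. Then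
`n_Ψ ≡ ∫_V |Ψ(x)|² d³x ≅ n_M`, i.e. `n_Ψ / n_M → 1`, with `n_M` the largest eigenvalue of `σ₁`
(`kernelMaxOccupation`): `Ψ` is, to a good approximation, `√n_M φ_M` — "the wave function of
the condensed particles", and `n_Ψ/N` "the fraction of condensed particles". (Proof in print:
(21) `f{φ} = |(φ,Ψ)|²/N + o(1)` since the eigenvalues of `N⁻¹(σ₁ - ΨΨ*)` are `o(1)` by (17), (8),
(12); maximise over `φ`.) Regularity made explicit: `σ_N`, `Ψ_N` measurable.
[cite: PenroseOnsager1956, §4 (20)–(22)] -/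
def PenroseOnsager1956_eq20 : Prop :=
  ∀ (ρ α : ℝ) (Λ : ℕ → Set Space) (σ : ℕ → Space → Space → ℂ) (Ψ : ℕ → Space → ℂ) (γ : ℝ → ℝ)
    (γM : ℝ), 0 < ρ → (∀ N, MeasurableSet (Λ N)) →
    (∀ᶠ N : ℕ in atTop, volume (Λ N) = ENNReal.ofReal (N / ρ)) →
    (∀ N, Measurable (uncurry (σ N))) → (∀ N, AEStronglyMeasurable (Ψ N) (volume.restrict (Λ N))) →
    (∀ r, 0 ≤ γ r) → (∀ r, γ r ≤ γM) → Tendsto γ atTop (𝓝 0) →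
    (∀ᶠ N in atTop, HasAsymptoticForm ρ (σ N) (Ψ N) γ (Λ N)) →
    (∀ᶠ N in atTop, ∀ q ∈ Λ N, ‖σ N q q‖ ≤ α * ρ) →
    IsExpOrderOne (fun N => (volume (Λ N)).toReal⁻¹ * ∫ x in Λ N, ‖Ψ N x‖) →
    Tendsto (fun N : ℕ => (∫ x in Λ N, ‖Ψ N x‖ ^ 2) /
      (kernelMaxOccupation (Λ N) (σ N)).toReal) atTop (𝓝 1)

end Literature.MathematicalPhysics.QuantumManyBody.BoseGas.PenroseOnsager

end
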